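import Summits.AtomisticToContinuum.HydrodynamicLimit.Theorems.CollisionIsometryCLTMacroClosureStubLedgerTransport
import Summits.AtomisticToContinuum.HydrodynamicLimit.Theorems.JaynesSqueezeSqueezeToBlockGibbsTimeZero

/-!
# `BlockGibbsToRelEntropy` (stmt-AtomisticToContinuum-13464), III: the relative entropy with respect to a local Gibbs reference is an explicit functional of the mean empirical fields

Route JaynesSqueeze, support item `BlockGibbsToRelEntropy`, step (d) ("bookkeeping at the Euler-driven
reference"), finite-`N` part. For the hard-sphere system on `𝕋³` started from the local Gibbs law
`λ_N = localGibbsLaw σ a₀ u₀ θ₀ N Φ` (continuous positive profiles, `0 < σ < 1/2`) and ANY local Gibbs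
reference `ψ = localGibbsLaw σ b w ϑ N Φ` with continuous positive profiles:

* `klDiv_lawAt_localGibbsLaw_ne_top` — `KL(lawAt Φ λ_N t ‖ ψ) < ∞` at every time (both laws have positive
  densities on the hard-sphere domain; the log-likelihood ratio is a one-body sum dominated by the kinetic
  energy, which is conserved along the flow and has Gaussian moments at time `0`);
* `toReal_klDiv_lawAt_localGibbsLaw_eq` — the EXACT finite-`N` bookkeeping
  `KL(lawAt Φ λ_N t ‖ ψ) = (N+1)·(E_λ⟨emp z, log prof₀⟩ − E_λ⟨emp (Φ_t z), log prof_ψ⟩) + log Z_ψ − log Z₀`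
  (the two-reference Liouville transport identity `MacroClosureLine.StubLedger.ledger_transport` of the tree
  with first reference `λ_N` itself, `KL(λ_N ‖ λ_N) = 0`);
* `tendsto_integral_logPair_zero` — the time-`0` term: under convergence of the MEAN empirical density fields,
  `E_λ⟨emp z, log prof₀⟩ → ∫ ρ₀ log a₀ + ∫ ρ₀ log (2πθ₀)^{-3/2} − 3/2` (exact Gaussian equipartition,
  `JaynesSqueezeSqueeze.integral_logPair_localGibbsLaw`). The time-`t` term is a combination of the three MEAN
  empirical fields at time `t` (companion file `…Pairings`), so the specific relative entropy is driven by
  the mean empirical fields at times `0` and `t` only.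

All objects are the tree's; no definitions. prover-pitem-stmt-AtomisticToContinuum-13464-0.
-/

noncomputable section

namespace Summit.AtomisticToContinuum.HydrodynamicLimit.Theorems.JaynesSqueezeClosure

open MeasureTheory Filter Set Topology InformationTheory
open scoped ENNReal
open Literature.MathematicalPhysics.KineticTheory Literature.Analysis.FluidPDE Literature.Analysis.FunctionSpaces
open MacroClosureLine.StubLedger JaynesSqueezeSqueeze

variable {σ : ℝ} {a₀ θ₀ b ϑ : T3 → ℝ} {u₀ w : T3 → V3}

/-! ### §1 Finiteness of the relative entropy with respect to a local Gibbs reference -/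

/-- **The relative entropy of the evolved law with respect to a local Gibbs reference is finite.** For
`σ ≤ 1/2`, continuous positive initial profiles `(a₀, u₀, θ₀)` and reference profiles `(b, w, ϑ)`, every
flow `Φ` and every time `t`: `KL(lawAt Φ λ_N t ‖ localGibbsLaw σ b w ϑ N Φ) ≠ ∞`. The evolved law is the
particle law of `W₀ ∘ Φ_{−t}` (mild Liouville equation), both densities are positive, and the log-likelihood
ratio pulled back by `Φ_t` is `log W₀ − log ψ ∘ Φ_t`, a one-body sum dominated by the kinetic energy at times
`0` and `t` (`integrable_kineticPair_localGibbsLaw`, `integrable_kineticPair_flow_localGibbsLaw`). [folklore] -/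
theorem klDiv_lawAt_localGibbsLaw_ne_top (hσ2 : σ ≤ 1 / 2) (ha : Continuous a₀) (hθ : Continuous θ₀)
    (hu : Continuous u₀) (ha0 : ∀ x, 0 < a₀ x) (hθ0 : ∀ x, 0 < θ₀ x) (hb : Continuous b) (hϑ : Continuous ϑ)
    (hw : Continuous w) (hb0 : ∀ x, 0 < b x) (hϑ0 : ∀ x, 0 < ϑ x) (N : ℕ)
    (Φ : HardSphereFlow (Torus.geometry (Fin 3)) (hsDiameter σ N) (N + 1)) (t : ℝ) :
    klDiv (Φ.lawAt (localGibbsLaw σ a₀ u₀ θ₀ N Φ) t) (localGibbsLaw σ b w ϑ N Φ) ≠ ⊤ := by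
  -- the two laws as particle laws of positive densities
  set W₀ : Config (N + 1) (Fin 3) T3 → ℝ := fun z =>
    (canonicalPartition (Torus.geometry (Fin 3)) (hsDiameter σ N) (N + 1) (localGibbsProfile a₀ u₀ θ₀))⁻¹ *
      tensorPow (N + 1) (localGibbsProfile a₀ u₀ θ₀) z with hW₀
  set ψ : Config (N + 1) (Fin 3) T3 → ℝ := fun z =>
    (canonicalPartition (Torus.geometry (Fin 3)) (hsDiameter σ N) (N + 1) (localGibbsProfile b w ϑ))⁻¹ *
      tensorPow (N + 1) (localGibbsProfile b w ϑ) z with hψ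
  have hK0 := integrable_kineticPair_localGibbsLaw hσ2 ha hθ hu ha0 hθ0 N Φ
  have hKt := integrable_kineticPair_flow_localGibbsLaw hσ2 ha hθ hu ha0 hθ0 N Φ t
  have hPl : IsProbabilityMeasure (localGibbsLaw σ a₀ u₀ θ₀ N Φ) :=
    isProbabilityMeasure_localGibbsLaw ha hθ hu ha0 hθ0 hσ2 N Φ
  have hPψ : IsProbabilityMeasure (localGibbsLaw σ b w ϑ N Φ) :=
    isProbabilityMeasure_localGibbsLaw hb hϑ hw hb0 hϑ0 hσ2 N Φ
  rw [localGibbsLaw_eq_particleLaw_tensorPow Φ a₀ θ₀ u₀] at hK0 hKt hPl ⊢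
  rw [localGibbsLaw_eq_particleLaw_tensorPow Φ b ϑ w] at hPψ ⊢
  have hWm : Measurable W₀ := measurable_gibbsDensity σ N ha hθ hu
  have hψm : Measurable ψ := measurable_gibbsDensity σ N hb hϑ hw
  have hW0 : ∀ z, 0 ≤ W₀ z := fun z => (gibbsDensity_pos hσ2 N ha hθ hu ha0 hθ0 z).le
  have hψpos : ∀ z, 0 < ψ z := gibbsDensity_pos hσ2 N hb hϑ hw hb0 hϑ0
  have hf : Measurable fun z => ENNReal.ofReal (W₀ z) := ENNReal.measurable_ofReal.comp hWm
  have hμL : particleLaw Φ W₀ ≪ liouville (Torus.geometry (Fin 3)) (N + 1) (hsDiameter σ N) :=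
    withDensity_absolutelyContinuous _ _
  have hgood : ∀ᵐ z ∂(particleLaw Φ W₀), z ∈ Φ.good := hμL.ae_le Φ.ae_mem_good
  -- the law at time `t` has density `W₀ ∘ Φ_{-t}`
  have hlaw : Φ.lawAt (particleLaw Φ W₀) t = particleLaw Φ fun z => W₀ (Φ.flow (-t) z) :=
    HardSphereFlow.lawAt_withDensity_holds Φ hf t
  haveI hPt : IsProbabilityMeasure (particleLaw Φ fun z => W₀ (Φ.flow (-t) z)) := by
    rw [← hlaw, HardSphereFlow.lawAt_eq]
    exact Measure.isProbabilityMeasure_map (Φ.measurable_flow t).aemeasurable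
  rw [hlaw]
  -- absolute continuity
  have hg : Measurable fun z => ENNReal.ofReal (ψ z) := ENNReal.measurable_ofReal.comp hψm
  have hg0 : ∀ᵐ z ∂(liouville (Torus.geometry (Fin 3)) (N + 1) (hsDiameter σ N)), ENNReal.ofReal (ψ z) ≠ 0 :=
    ae_of_all _ fun z => (ENNReal.ofReal_pos.mpr (hψpos z)).ne'
  have hac : (particleLaw Φ fun z => W₀ (Φ.flow (-t) z)) ≪ particleLaw Φ ψ :=
    (withDensity_absolutelyContinuous _ _).trans (withDensity_absolutelyContinuous' hg.aemeasurable hg0)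
  -- integrability of the log-likelihood ratio
  have hllr := llr_particleLaw_ae (W := fun z => W₀ (Φ.flow (-t) z)) Φ (hWm.comp (Φ.measurable_flow (-t))) hψm
    (fun z => hW0 _) hψpos
  have hlogW : ∀ z, Real.log (W₀ z) =
      ((N : ℝ) + 1) * (∫ y, Real.log (localGibbsProfile a₀ u₀ θ₀ y) ∂(empiricalMeasure z)) -
        Real.log (canonicalPartition (Torus.geometry (Fin 3)) (hsDiameter σ N) (N + 1)
          (localGibbsProfile a₀ u₀ θ₀)) :=
    log_gibbsDensity hσ2 N ha hθ hu ha0 hθ0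
  have hlogψ : ∀ z, Real.log (ψ z) =
      ((N : ℝ) + 1) * (∫ y, Real.log (localGibbsProfile b w ϑ y) ∂(empiricalMeasure z)) -
        Real.log (canonicalPartition (Torus.geometry (Fin 3)) (hsDiameter σ N) (N + 1)
          (localGibbsProfile b w ϑ)) :=
    log_gibbsDensity hσ2 N hb hϑ hw hb0 hϑ0
  have hI₁ : Integrable (fun z => Real.log (W₀ z)) (particleLaw Φ W₀) := by
    simp_rw [hlogW]
    exact ((integrable_logPair_comp ha hθ hu ha0 hθ0 measurable_id hK0).const_mul _).sub (integrable_const _)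
  have hI₂ : Integrable (fun z => Real.log (ψ (Φ.flow t z))) (particleLaw Φ W₀) := by
    simp_rw [hlogψ]
    exact ((integrable_logPair_comp hb hϑ hw hb0 hϑ0 (Φ.measurable_flow t) hKt).const_mul _).sub
      (integrable_const _)
  have hF : Measurable fun x => Real.log (W₀ (Φ.flow (-t) x)) - Real.log (ψ x) :=
    (Real.measurable_log.comp (hWm.comp (Φ.measurable_flow (-t)))).sub (Real.measurable_log.comp hψm)
  have hint : Integrable (fun x => Real.log (W₀ (Φ.flow (-t) x)) - Real.log (ψ x))
      (particleLaw Φ fun z => W₀ (Φ.flow (-t) z)) := by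
    rw [← hlaw, HardSphereFlow.lawAt_eq]
    refine (integrable_map_measure hF.aestronglyMeasurable (Φ.measurable_flow t).aemeasurable).2 ?_
    refine (hI₁.sub hI₂).congr ?_
    filter_upwards [hgood] with z hz
    simp only [Function.comp_apply, Pi.sub_apply]
    rw [Φ.flow_neg_flow t hz]
  exact klDiv_ne_top_iff.2 ⟨hac, hint.congr hllr.symm⟩

/-! ### §2 The finite-`N` bookkeeping -/

/-- **Yau's relative entropy with respect to a local Gibbs reference is an explicit one-body functional**
(finite `N`, exact). For `0 < σ < 1/2`, continuous positive `(a₀, u₀, θ₀)` and `(b, w, ϑ)`, a flow `Φ` and a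
time `t`:
`KL(lawAt Φ λ_N t ‖ localGibbsLaw σ b w ϑ N Φ) = (N+1)·(E_λ⟨emp z, log prof_{a₀,u₀,θ₀}⟩ −
E_λ⟨emp (Φ_t z), log prof_{b,w,ϑ}⟩) + log Z_{b,w,ϑ} − log Z_{a₀,u₀,θ₀}`
— the transport identity `ledger_transport` with first reference `λ_N` (`KL(λ_N ‖ λ_N) = 0`), the kinetic
energy being integrable at both times. [cite: Yau1991, §2] -/
theorem toReal_klDiv_lawAt_localGibbsLaw_eq (hσ : 0 < σ) (hσ2 : σ < 2⁻¹) (ha : Continuous a₀)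
    (hθ : Continuous θ₀) (hu : Continuous u₀) (ha0 : ∀ x, 0 < a₀ x) (hθ0 : ∀ x, 0 < θ₀ x)
    (hb : Continuous b) (hϑ : Continuous ϑ) (hw : Continuous w) (hb0 : ∀ x, 0 < b x) (hϑ0 : ∀ x, 0 < ϑ x)
    (N : ℕ) (Φ : HardSphereFlow (Torus.geometry (Fin 3)) (hsDiameter σ N) (N + 1)) (t : ℝ) :
    (klDiv (Φ.lawAt (localGibbsLaw σ a₀ u₀ θ₀ N Φ) t) (localGibbsLaw σ b w ϑ N Φ)).toReal =
      ((N : ℝ) + 1) *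
          ((∫ z, (∫ y, Real.log (localGibbsProfile a₀ u₀ θ₀ y) ∂(empiricalMeasure z))
              ∂(localGibbsLaw σ a₀ u₀ θ₀ N Φ)) -
            ∫ z, (∫ y, Real.log (localGibbsProfile b w ϑ y) ∂(empiricalMeasure (Φ.flow t z)))
              ∂(localGibbsLaw σ a₀ u₀ θ₀ N Φ)) +
        Real.log (canonicalPartition (Torus.geometry (Fin 3)) (hsDiameter σ N) (N + 1) (localGibbsProfile b w ϑ)) -
        Real.log (canonicalPartition (Torus.geometry (Fin 3)) (hsDiameter σ N) (N + 1)
          (localGibbsProfile a₀ u₀ θ₀)) := by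
  have hσ2' : σ ≤ 1 / 2 := by rw [one_div]; exact hσ2.le
  have _ := hσ
  set W₀ : Config (N + 1) (Fin 3) T3 → ℝ := fun z =>
    (canonicalPartition (Torus.geometry (Fin 3)) (hsDiameter σ N) (N + 1) (localGibbsProfile a₀ u₀ θ₀))⁻¹ *
      tensorPow (N + 1) (localGibbsProfile a₀ u₀ θ₀) z with hW₀
  have hK0 := integrable_kineticPair_localGibbsLaw hσ2' ha hθ hu ha0 hθ0 N Φ
  have hKt := integrable_kineticPair_flow_localGibbsLaw hσ2' ha hθ hu ha0 hθ0 N Φ t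
  have hPl : IsProbabilityMeasure (localGibbsLaw σ a₀ u₀ θ₀ N Φ) :=
    isProbabilityMeasure_localGibbsLaw ha hθ hu ha0 hθ0 hσ2' N Φ
  have hlam : localGibbsLaw σ a₀ u₀ θ₀ N Φ = particleLaw Φ W₀ := localGibbsLaw_eq_particleLaw_tensorPow Φ a₀ θ₀ u₀
  have hkl : klDiv (particleLaw Φ W₀) (localGibbsLaw σ a₀ u₀ θ₀ N Φ) ≠ ⊤ := by
    rw [← hlam, klDiv_self]; exact ENNReal.zero_ne_top
  rw [hlam] at hK0 hKt hPl
  have h := ledger_transport hσ2 N Φ a₀ θ₀ b ϑ u₀ w ha hθ hu hb hϑ hw ha0 hθ0 hb0 hϑ0 W₀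
    (measurable_gibbsDensity σ N ha hθ hu) (fun z => (gibbsDensity_pos hσ2' N ha hθ hu ha0 hθ0 z).le) hPl hkl t hK0 hKt
  rw [← hlam] at h
  haveI := isProbabilityMeasure_localGibbsLaw ha hθ hu ha0 hθ0 hσ2' N Φ
  rw [h, klDiv_self, ENNReal.toReal_zero, zero_add]

/-! ### §3 The mean log-profile pairing at time zero -/

/-- **Limit of the mean log-profile pairing at time zero.** Under the local Gibbs laws of continuous positive
profiles (`σ ≤ 1/2`), if the MEAN empirical density fields converge, `E_λ[ρ̂_z(χ)] → ∫ χ ρ₀` for every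
continuous `χ`, then `E_λ⟨emp z, log prof_{a₀,u₀,θ₀}⟩ → ∫ ρ₀ log a₀ + ∫ ρ₀ log (2πθ₀)^{-3/2} − 3/2` (exact
Gaussian equipartition `integral_logPair_localGibbsLaw` + the two density limits). [folklore] -/
theorem tendsto_integral_logPair_zero (hσ2 : σ ≤ 1 / 2) (ha : Continuous a₀) (hθ : Continuous θ₀)
    (hu : Continuous u₀) (ha0 : ∀ x, 0 < a₀ x) (hθ0 : ∀ x, 0 < θ₀ x)
    (Φ : (N : ℕ) → HardSphereFlow (Torus.geometry (Fin 3)) (hsDiameter σ N) (N + 1)) {ρ₀ : T3 → ℝ}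
    (hD0 : ∀ χ : T3 → ℝ, Continuous χ → Tendsto (fun N : ℕ => ∫ z, empiricalDensityField z χ
      ∂(localGibbsLaw σ a₀ u₀ θ₀ N (Φ N))) atTop (𝓝 (∫ x, χ x * ρ₀ x))) :
    Tendsto (fun N : ℕ => ∫ z, (∫ y, Real.log (localGibbsProfile a₀ u₀ θ₀ y) ∂(empiricalMeasure z))
        ∂(localGibbsLaw σ a₀ u₀ θ₀ N (Φ N))) atTop
      (𝓝 ((∫ x, Real.log (a₀ x) * ρ₀ x) +
        (∫ x, Real.log ((2 * Real.pi * θ₀ x) ^ (-(Module.finrank ℝ V3 : ℝ) / 2)) * ρ₀ x) - 3 / 2)) := by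
  have hRc : Continuous fun x => (2 * Real.pi * θ₀ x) ^ (-(Module.finrank ℝ V3 : ℝ) / 2) :=
    (continuous_const.mul hθ).rpow_const fun x => Or.inl (mul_pos (mul_pos two_pos Real.pi_pos) (hθ0 x)).ne'
  have hRlog : Continuous fun x => Real.log ((2 * Real.pi * θ₀ x) ^ (-(Module.finrank ℝ V3 : ℝ) / 2)) :=
    hRc.log fun x => (Real.rpow_pos_of_pos (mul_pos (mul_pos two_pos Real.pi_pos) (hθ0 x)) _).ne'
  have h := ((hD0 _ (ha.log fun x => (ha0 x).ne')).add (hD0 _ hRlog)).sub_const (3 / 2)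
  refine h.congr fun N => ?_
  rw [integral_logPair_localGibbsLaw hσ2 ha hθ hu ha0 hθ0 N (Φ N)]

end Summit.AtomisticToContinuum.HydrodynamicLimit.Theorems.JaynesSqueezeClosure

end
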